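import Literature.NumberTheory.F1Geometry.HaranWittFrobenius
import Literature.NumberTheory.Sieve.RamanujanSumHoelder
import HarnessLib

/-!
# Haran's trace functionals `t_m = tr ∘ F_m` on `𝒲_N` are Ramanujan sums (Haran 2022, §13)

Source: M. J. Shai Haran, *Non-Additive Geometry and Frobenius Correspondences*, arXiv:2209.08536,
§13 [Haran2022]: `t_m(φ_n) = tr(F_m φ_n) = ∑_{ξ ∈ μ_n^*} ξ^m = C_n^m` "with the Ramanujan sums
`C_n^m = μ(n/(n,m)) · φ(n)/φ(n/(n,m))`".

`Literature.NumberTheory.F1Geometry.HaranWitt.moebius_dotProduct_frob` gives the level-`N` value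
`t_m(φ_d) = μ(d/(d,m)) · φ(d)/φ(d/(d,m))` from the definitions; Hölder's identity
(`Literature.NumberTheory.Sieve.ramanujanDivisorSum_mul_totient_div`, Hardy–Wright Thm 272)
identifies this number with the Ramanujan sum `c_d(m) = ∑_{a mod d, (a,d)=1} e(am/d)`
(`Literature.NumberTheory.Sieve.ramanujanSum`, in Kluyver's form `ramanujanDivisorSum`), i.e. with
the exponential sum `∑_{ξ ∈ μ_d^*} ξ^m` of the source.  All proved; no definitions, no named facts.
-/

namespace Literature.NumberTheory.F1Geometry

namespace HaranWitt

open Finset Literature.NumberTheory.Sieve ArithmeticFunction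
open scoped ArithmeticFunction.Moebius

/-- **`μ(d/(d,m)) · φ(d)/φ(d/(d,m)) = c_d(m)`** (`d > 0`): Haran's printed value of `t_m(φ_d)` is the
Ramanujan sum in Kluyver's form `∑_{e ∣ (d,m)} e μ(d/e)` (Hölder; Hardy–Wright Thm 272).
[cite: Haran2022, §13] -/
theorem moebius_mul_coeff_eq_ramanujanDivisorSum {d : ℕ} (hd : 0 < d) (m : ℕ) :
    (μ (target m d) : ℚ) * coeff m d = (ramanujanDivisorSum m d : ℚ) := by
  have ht : target m d = d / Nat.gcd d m := by rw [target, Nat.gcd_comm]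
  have ht0 : 0 < target m d :=
    Nat.div_pos (Nat.le_of_dvd hd (Nat.gcd_dvd_right m d)) (Nat.gcd_pos_of_pos_right m hd)
  have hφ : (Nat.totient (target m d) : ℚ) ≠ 0 :=
    Nat.cast_ne_zero.mpr (Nat.totient_pos.mpr ht0).ne'
  have key := ramanujanDivisorSum_mul_totient_div m d
  rw [← ht] at key
  have key' : (ramanujanDivisorSum m d : ℚ) * (Nat.totient (target m d) : ℚ) =
      (μ (target m d) : ℚ) * (Nat.totient d : ℚ) := by exact_mod_cast key
  rw [coeff, mul_div_assoc', eq_comm, eq_div_iff hφ]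
  exact key'

/-- **`t_m(φ_d) = c_d(m)` at level `N`**: pairing the column of `φ_d` in `F_m` with the trace
vector `(μ(e))_{e ∣ N}` (`tr φ_e = μ(e)`) gives the Ramanujan sum `c_d(m)` (Kluyver/integer form).
[cite: Haran2022, §13] -/
theorem moebius_dotProduct_frob_eq_ramanujanDivisorSum (N m : ℕ) (d : N.divisors) :
    ∑ e : N.divisors, (μ (e : ℕ) : ℚ) * frob N m e d = (ramanujanDivisorSum m d : ℚ) := by
  rw [moebius_dotProduct_frob, moebius_mul_coeff_eq_ramanujanDivisorSum (Nat.pos_of_mem_divisors d.2)]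

/-- **`t_m(φ_d) = ∑_{ξ ∈ μ_d^*} ξ^m`** (Haran 2022, §13, `t_m(φ_n) = ∑_{ξ ∈ μ_n^*} ξ^m = C_n^m`): the
level-`N` trace functional equals the exponential sum `c_d(m) = ∑_{a mod d, (a,d)=1} e(am/d)`
(`Literature.NumberTheory.Sieve.ramanujanSum d m`). [cite: Haran2022, §13] -/
theorem moebius_dotProduct_frob_eq_ramanujanSum (N m : ℕ) (d : N.divisors) :
    ((∑ e : N.divisors, (μ (e : ℕ) : ℚ) * frob N m e d : ℚ) : ℂ) = ramanujanSum d m := by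
  rw [moebius_dotProduct_frob_eq_ramanujanDivisorSum, ramanujanSum_eq_ramanujanDivisorSum,
    Int.natAbs_natCast, Rat.cast_intCast]

end HaranWitt

end Literature.NumberTheory.F1Geometry
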